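import Summits.ResolutionOfSingularities.ResolutionOfSingularities.Theorems.FrobeniusClosingSteerDescentSpaceAdapted
import HarnessLib

/-!
# Descent space, file 4 (W4.1, F-B card 7): the shear `c ↦ e_{i₀}` and L2b — `c ∈ W(Φ) ⟺ Φ + Q²` invariant along `c`

W4.1, crux `Steer` (stmt-ResolutionOfSingularities-16345), frontier piece F-B; polynomial cores of res-L0-w41-idea-1's card 7
`kangaroo-free-parity-automaton` (`Sketch-idea-1-v9-fb.lean` 1cd28c90a6f7445c; res-L0-w41-plan-1 RULINGS 81b/84d; idea-1 g8
«citable: yes»). Over files 1–3 (seat res-D-pv-007 AS res-L0-w41-stub-5):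

* §6 the SHEAR `θ_c` (`X_{i₀} ↦ c_{i₀} X_{i₀}`, `X_i ↦ X_i + c_i X_{i₀}`, i.e. `P ↦ P ∘ A` with `A e_{i₀} = c`; `c_{i₀} ≠ 0`) and its
  inverse, written as explicit `aeval`s (no definitions): they intertwine translation along `c` with translation along
  `e_{i₀}` (`genTransl_single_shear`, `genTransl_unshear`), commute with constant extension (`map_shear`, `map_unshear`),
  are mutually inverse (`shear_unshear`, `unshear_shear`), transport line invariance (`isLineInvariant_iff_shear`), satisfy
  the chain rule (`pderiv_shear_of_ne`, `pderiv_shear_self`) and hence TRANSPORT THE DESCENT SPACE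
  (`mem_descentSpace_iff_shear`: `c ∈ W(Φ) ⟺ e_{i₀} ∈ W(θ_c Φ)`);
* **`mem_descentSpace_iff_exists_sq`** = the sketch's L2b `stub_descent_iff_sq_adapted` for EVERY vector `c` (PROVED): over a
  perfect field of characteristic `2`, `c ∈ W(Φ) ⟺ ∃ Q, Φ + Q²` is invariant along `κ̄·c`.

OURS (research support for an idea card; candidates, not facts); nothing here is a statement of the manuscript under review
[claim: Hironaka2017, status: under-review]; AI work, weaker than expert review. [cite: CossartPiltant2009, p. 9] [folklore]
-/

noncomputable section

-- `Summit.<S>.<S>.…` duplicates the summit name by design (single-problem summit).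
set_option linter.dupNamespace false

open MvPolynomial

namespace Summit.ResolutionOfSingularities.ResolutionOfSingularities.Theorems.SwitchingDichotomy.DescentSpace

universe u v

/-! ## §6 Linear change of coordinates `c ↦ e_{i₀}` (any `c` with `c i₀ ≠ 0`) and L2b for a general vector -/

section Shear

variable {κ : Type u} [Field κ] {σ : Type v} [DecidableEq σ]

omit [DecidableEq σ] in
/-- Every polynomial is invariant along the zero vector. [folklore] -/
theorem isLineInvariant_zero_dir (P : MvPolynomial σ κ) : IsLineInvariant κ (0 : σ → κ) P := by
  unfold IsLineInvariant genTransl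
  have : (fun i : σ => (X i : MvPolynomial σ (Polynomial κ)) + C (Polynomial.C ((0 : σ → κ) i) * Polynomial.X)) =
      fun i => X i := by
    funext i; simp
  rw [this]
  induction P using MvPolynomial.induction_on with
  | C a =>
    rw [aeval_C, map_C, IsScalarTower.algebraMap_apply κ (Polynomial κ) (MvPolynomial σ (Polynomial κ)),
      MvPolynomial.algebraMap_eq]
  | add p q hp hq => rw [map_add, map_add, hp, hq]
  | mul_X p i hp => rw [map_mul, map_mul, hp, aeval_X, map_X]

/-- The SHEAR `θ_c` (`X_{i₀} ↦ c_{i₀} X_{i₀}`, `X_i ↦ X_i + c_i X_{i₀}`; i.e. `P ↦ P ∘ A` with `A e_{i₀} = c`, `A e_i = e_i`)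
intertwines translation along `e_{i₀}` upstairs with translation along `c` downstairs:
`(θ P)(X + t e_{i₀}) = Θ (P(X + t c))`, `Θ` the same shear over `κ[t]`. [folklore] -/
theorem genTransl_single_shear (c : σ → κ) (i₀ : σ) (P : MvPolynomial σ κ) :
    genTransl κ (Pi.single i₀ 1)
        (aeval (fun i => if i = i₀ then C (c i₀) * X i₀ else X i + C (c i) * X i₀) P) =
      aeval (fun i => if i = i₀ then C (Polynomial.C (c i₀)) * X i₀
          else (X i : MvPolynomial σ (Polynomial κ)) + C (Polynomial.C (c i)) * X i₀) (genTransl κ c P) := by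
  induction P using MvPolynomial.induction_on with
  | C a => rw [aeval_C, MvPolynomial.algebraMap_eq, genTransl_C, genTransl_C, aeval_C, MvPolynomial.algebraMap_eq]
  | add p q hp hq => rw [map_add, map_add, hp, hq, map_add, map_add]
  | mul_X p i hp =>
    rw [map_mul, map_mul, hp, map_mul, map_mul, aeval_X, genTransl_X, map_add, aeval_X, aeval_C,
      MvPolynomial.algebraMap_eq]
    congr 1
    by_cases hi : i = i₀
    · subst hi
      simp only [if_true, map_mul, map_one, genTransl_C, genTransl_X, Pi.single_eq_same, one_mul]
      ring
    · simp only [if_neg hi, map_add, map_mul, map_zero, map_one, genTransl_C, genTransl_X, Pi.single_eq_same,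
        Pi.single_eq_of_ne hi, zero_mul, add_zero, one_mul]
      ring

/-- The shear commutes with constant extension of scalars. [folklore] -/
theorem map_shear (c : σ → κ) (i₀ : σ) (P : MvPolynomial σ κ) :
    map (algebraMap κ (Polynomial κ))
        (aeval (fun i => if i = i₀ then C (c i₀) * X i₀ else X i + C (c i) * X i₀) P) =
      aeval (fun i => if i = i₀ then C (Polynomial.C (c i₀)) * X i₀
          else (X i : MvPolynomial σ (Polynomial κ)) + C (Polynomial.C (c i)) * X i₀)
        (map (algebraMap κ (Polynomial κ)) P) := by
  induction P using MvPolynomial.induction_on with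
  | C a => rw [aeval_C, MvPolynomial.algebraMap_eq, map_C, aeval_C, MvPolynomial.algebraMap_eq]
  | add p q hp hq => rw [map_add, map_add, hp, hq, map_add, map_add]
  | mul_X p i hp =>
    rw [map_mul, map_mul, hp, map_mul, map_X, map_mul, aeval_X, aeval_X]
    congr 1
    by_cases hi : i = i₀
    · subst hi; simp [Polynomial.algebraMap_eq]
    · simp [if_neg hi, Polynomial.algebraMap_eq]

/-- The INVERSE SHEAR `θ_c⁻¹` (`X_{i₀} ↦ c_{i₀}⁻¹ X_{i₀}`, `X_i ↦ X_i − c_i c_{i₀}⁻¹ X_{i₀}`, for `c_{i₀} ≠ 0`) intertwines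
translation along `c` upstairs with translation along `e_{i₀}` downstairs. [folklore] -/
theorem genTransl_unshear {c : σ → κ} {i₀ : σ} (hc : c i₀ ≠ 0) (Q : MvPolynomial σ κ) :
    genTransl κ c
        (aeval (fun i => if i = i₀ then C (c i₀)⁻¹ * X i₀ else X i - C (c i * (c i₀)⁻¹) * X i₀) Q) =
      aeval (fun i => if i = i₀ then C (Polynomial.C (c i₀)⁻¹) * X i₀
          else (X i : MvPolynomial σ (Polynomial κ)) - C (Polynomial.C (c i * (c i₀)⁻¹)) * X i₀)
        (genTransl κ (Pi.single i₀ 1) Q) := by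
  induction Q using MvPolynomial.induction_on with
  | C a => rw [aeval_C, MvPolynomial.algebraMap_eq, genTransl_C, genTransl_C, aeval_C, MvPolynomial.algebraMap_eq]
  | add p q hp hq => rw [map_add, map_add, hp, hq, map_add, map_add]
  | mul_X p i hp =>
    rw [map_mul, map_mul, hp, map_mul, map_mul, aeval_X, genTransl_X, map_add, aeval_X, aeval_C,
      MvPolynomial.algebraMap_eq]
    congr 1
    have hCC : (C (Polynomial.C (c i₀)⁻¹) : MvPolynomial σ (Polynomial κ)) * C (Polynomial.C (c i₀)) = 1 := by
      rw [← map_mul, ← Polynomial.C_mul, inv_mul_cancel₀ hc, Polynomial.C_1, map_one]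
    by_cases hi : i = i₀
    · subst hi
      simp only [if_true, map_mul, map_one, genTransl_C, genTransl_X, Pi.single_eq_same, one_mul]
      linear_combination (C (Polynomial.X : Polynomial κ) : MvPolynomial σ (Polynomial κ)) * hCC
    · simp only [if_neg hi, map_sub, map_mul, map_zero, genTransl_C, genTransl_X,
        Pi.single_eq_of_ne hi, zero_mul, add_zero]
      linear_combination (-(C (Polynomial.C (c i)) * C (Polynomial.X : Polynomial κ) :
        MvPolynomial σ (Polynomial κ))) * hCC

/-- The inverse shear commutes with constant extension of scalars. [folklore] -/
theorem map_unshear (c : σ → κ) (i₀ : σ) (Q : MvPolynomial σ κ) :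
    map (algebraMap κ (Polynomial κ))
        (aeval (fun i => if i = i₀ then C (c i₀)⁻¹ * X i₀ else X i - C (c i * (c i₀)⁻¹) * X i₀) Q) =
      aeval (fun i => if i = i₀ then C (Polynomial.C (c i₀)⁻¹) * X i₀
          else (X i : MvPolynomial σ (Polynomial κ)) - C (Polynomial.C (c i * (c i₀)⁻¹)) * X i₀)
        (map (algebraMap κ (Polynomial κ)) Q) := by
  induction Q using MvPolynomial.induction_on with
  | C a => rw [aeval_C, MvPolynomial.algebraMap_eq, map_C, aeval_C, MvPolynomial.algebraMap_eq]
  | add p q hp hq => rw [map_add, map_add, hp, hq, map_add, map_add]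
  | mul_X p i hp =>
    rw [map_mul, map_mul, hp, map_mul, map_X, map_mul, aeval_X, aeval_X]
    congr 1
    by_cases hi : i = i₀
    · subst hi; simp [Polynomial.algebraMap_eq]
    · simp [if_neg hi, Polynomial.algebraMap_eq]

/-- `θ_c ∘ θ_c⁻¹ = id`. [folklore] -/
theorem shear_unshear {c : σ → κ} {i₀ : σ} (hc : c i₀ ≠ 0) (Q : MvPolynomial σ κ) :
    aeval (fun i => if i = i₀ then C (c i₀) * X i₀ else X i + C (c i) * X i₀)
      (aeval (fun i => if i = i₀ then C (c i₀)⁻¹ * X i₀ else X i - C (c i * (c i₀)⁻¹) * X i₀) Q) = Q := by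
  induction Q using MvPolynomial.induction_on with
  | C a => rw [aeval_C, MvPolynomial.algebraMap_eq, aeval_C, MvPolynomial.algebraMap_eq]
  | add p q hp hq => rw [map_add, map_add, hp, hq]
  | mul_X p i hp =>
    rw [map_mul, map_mul, hp, aeval_X]
    congr 1
    by_cases hi : i = i₀
    · subst hi
      simp only [if_true, map_mul, aeval_C, MvPolynomial.algebraMap_eq, aeval_X]
      rw [← mul_assoc, ← C_mul, inv_mul_cancel₀ hc, C_1, one_mul]
    · have hC : (C (c i₀)⁻¹ : MvPolynomial σ κ) * C (c i₀) = 1 := by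
        rw [← C_mul, inv_mul_cancel₀ hc, C_1]
      simp only [if_neg hi, map_sub, map_mul, aeval_C, MvPolynomial.algebraMap_eq, aeval_X, if_true]
      linear_combination (-(C (c i) * X i₀ : MvPolynomial σ κ)) * hC

/-- `θ_c⁻¹ ∘ θ_c = id`. [folklore] -/
theorem unshear_shear {c : σ → κ} {i₀ : σ} (hc : c i₀ ≠ 0) (P : MvPolynomial σ κ) :
    aeval (fun i => if i = i₀ then C (c i₀)⁻¹ * X i₀ else X i - C (c i * (c i₀)⁻¹) * X i₀)
      (aeval (fun i => if i = i₀ then C (c i₀) * X i₀ else X i + C (c i) * X i₀) P) = P := by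
  induction P using MvPolynomial.induction_on with
  | C a => rw [aeval_C, MvPolynomial.algebraMap_eq, aeval_C, MvPolynomial.algebraMap_eq]
  | add p q hp hq => rw [map_add, map_add, hp, hq]
  | mul_X p i hp =>
    rw [map_mul, map_mul, hp, aeval_X]
    congr 1
    by_cases hi : i = i₀
    · subst hi
      simp only [if_true, map_mul, aeval_C, MvPolynomial.algebraMap_eq, aeval_X]
      rw [← mul_assoc, ← C_mul, mul_inv_cancel₀ hc, C_1, one_mul]
    · simp only [if_neg hi, map_add, map_mul, aeval_C, MvPolynomial.algebraMap_eq, aeval_X, if_true]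
      ring

/-- **Line invariance is transported by the shear**: `P` is invariant along `c` iff `θ_c P` is invariant along `e_{i₀}`
(`c_{i₀} ≠ 0`). [folklore] -/
theorem isLineInvariant_iff_shear {c : σ → κ} {i₀ : σ} (hc : c i₀ ≠ 0) (P : MvPolynomial σ κ) :
    IsLineInvariant κ c P ↔ IsLineInvariant κ (Pi.single i₀ 1)
      (aeval (fun i => if i = i₀ then C (c i₀) * X i₀ else X i + C (c i) * X i₀) P) := by
  unfold IsLineInvariant
  constructor
  · intro h
    rw [genTransl_single_shear, h, map_shear]
  · intro h
    have h' := congrArg (aeval (fun i => if i = i₀ then C (Polynomial.C (c i₀)⁻¹) * X i₀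
      else (X i : MvPolynomial σ (Polynomial κ)) - C (Polynomial.C (c i * (c i₀)⁻¹)) * X i₀)) h
    rw [← genTransl_unshear hc, ← map_unshear, unshear_shear hc] at h'
    exact h'

/-- Partial derivatives of the shear's linear forms, off the pivot: `∂_i (θ_c X_j) = δ_{ij}` (`i ≠ i₀`). [folklore] -/
theorem pderiv_shearForm_of_ne (c : σ → κ) {i₀ i : σ} (hi : i ≠ i₀) (j : σ) :
    pderiv i ((if j = i₀ then C (c i₀) * X i₀ else X j + C (c j) * X i₀ : MvPolynomial σ κ)) =
      (Pi.single i 1 : σ → MvPolynomial σ κ) j := by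
  by_cases hj : j = i₀
  · subst hj
    rw [if_pos rfl, Derivation.leibniz, pderiv_C, pderiv_X, smul_zero, add_zero, Pi.single_eq_of_ne hi.symm,
      smul_zero]
  · rw [if_neg hj, map_add, Derivation.leibniz, pderiv_C, pderiv_X, pderiv_X, smul_zero, add_zero,
      Pi.single_eq_of_ne hi.symm, smul_zero, add_zero]

/-- Partial derivatives of the shear's linear forms at the pivot: `∂_{i₀} (θ_c X_j) = c_j`. [folklore] -/
theorem pderiv_shearForm_self (c : σ → κ) (i₀ j : σ) :
    pderiv i₀ ((if j = i₀ then C (c i₀) * X i₀ else X j + C (c j) * X i₀ : MvPolynomial σ κ)) = C (c j) := by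
  by_cases hj : j = i₀
  · subst hj
    rw [if_pos rfl, Derivation.leibniz, pderiv_C, pderiv_X, smul_zero, add_zero, Pi.single_eq_same, smul_eq_mul,
      mul_one]
  · rw [if_neg hj, map_add, Derivation.leibniz, pderiv_C, pderiv_X, pderiv_X, smul_zero, add_zero,
      Pi.single_eq_same, Pi.single_eq_of_ne hj, zero_add, smul_eq_mul, mul_one]

/-- The shear fixes the constants `δ_{ij}`. [folklore] -/
theorem aeval_shear_single (c : σ → κ) (i₀ i j : σ) :
    aeval (fun i => if i = i₀ then C (c i₀) * X i₀ else X i + C (c i) * X i₀)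
      ((Pi.single i 1 : σ → MvPolynomial σ κ) j) = (Pi.single i 1 : σ → MvPolynomial σ κ) j := by
  by_cases hij : j = i
  · subst hij; rw [Pi.single_eq_same, map_one]
  · rw [Pi.single_eq_of_ne hij, map_zero]

/-- **Chain rule for the shear, off the pivot**: `∂_i (θ_c P) = θ_c (∂_i P)` for `i ≠ i₀`. [folklore] -/
theorem pderiv_shear_of_ne (c : σ → κ) {i₀ i : σ} (hi : i ≠ i₀) (P : MvPolynomial σ κ) :
    pderiv i (aeval (fun i => if i = i₀ then C (c i₀) * X i₀ else X i + C (c i) * X i₀) P) =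
      aeval (fun i => if i = i₀ then C (c i₀) * X i₀ else X i + C (c i) * X i₀) (pderiv i P) := by
  induction P using MvPolynomial.induction_on with
  | C a => rw [aeval_C, MvPolynomial.algebraMap_eq, pderiv_C, map_zero]
  | add p q hp hq => rw [map_add, map_add, hp, hq, map_add, map_add]
  | mul_X p j hp =>
    rw [map_mul, aeval_X, Derivation.leibniz, Derivation.leibniz, smul_eq_mul, smul_eq_mul, smul_eq_mul,
      smul_eq_mul, hp, pderiv_shearForm_of_ne c hi j, map_add, map_mul, map_mul, aeval_X, pderiv_X,
      aeval_shear_single]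

/-- **Chain rule for the shear at the pivot**: `∂_{i₀} (θ_c P) = Σ_k c_k · θ_c (∂_k P)`. [folklore] -/
theorem pderiv_shear_self [Fintype σ] (c : σ → κ) (i₀ : σ) (P : MvPolynomial σ κ) :
    pderiv i₀ (aeval (fun i => if i = i₀ then C (c i₀) * X i₀ else X i + C (c i) * X i₀) P) =
      ∑ k, c k • aeval (fun i => if i = i₀ then C (c i₀) * X i₀ else X i + C (c i) * X i₀) (pderiv k P) := by
  induction P using MvPolynomial.induction_on with
  | C a => simp [MvPolynomial.algebraMap_eq]
  | add p q hp hq =>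
    rw [map_add, map_add, hp, hq, ← Finset.sum_add_distrib]
    exact Finset.sum_congr rfl fun k _ => by rw [map_add, map_add, smul_add]
  | mul_X p j hp =>
    rw [map_mul, aeval_X, Derivation.leibniz, smul_eq_mul, smul_eq_mul, hp, pderiv_shearForm_self]
    -- right-hand side
    have hrhs : ∀ k, c k • aeval (fun i => if i = i₀ then C (c i₀) * X i₀ else X i + C (c i) * X i₀)
        (pderiv k (p * X j)) =
        c k • (aeval (fun i => if i = i₀ then C (c i₀) * X i₀ else X i + C (c i) * X i₀) p *
          (Pi.single k 1 : σ → MvPolynomial σ κ) j) +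
        (if j = i₀ then C (c i₀) * X i₀ else X j + C (c j) * X i₀) *
          (c k • aeval (fun i => if i = i₀ then C (c i₀) * X i₀ else X i + C (c i) * X i₀) (pderiv k p)) := by
      intro k
      rw [Derivation.leibniz, smul_eq_mul, smul_eq_mul, map_add, map_mul, map_mul, aeval_X, pderiv_X,
        aeval_shear_single, smul_add, mul_smul_comm]
    have h1 : (∑ k, c k • (aeval (fun i => if i = i₀ then C (c i₀) * X i₀ else X i + C (c i) * X i₀) p *
          (Pi.single k 1 : σ → MvPolynomial σ κ) j)) =
        aeval (fun i => if i = i₀ then C (c i₀) * X i₀ else X i + C (c i) * X i₀) p * C (c j) := by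
      rw [Finset.sum_eq_single j (fun k _ hk => by rw [Pi.single_eq_of_ne (Ne.symm hk), mul_zero, smul_zero])
        (fun h => absurd (Finset.mem_univ j) h), Pi.single_eq_same, mul_one, smul_eq_C_mul, mul_comm]
    rw [Finset.sum_congr rfl fun k _ => hrhs k, Finset.sum_add_distrib, ← Finset.mul_sum, h1]

/-- The pivot chain rule with the sum inside `θ_c`: `∂_{i₀} (θ_c P) = θ_c (Σ_k c_k • ∂_k P)`. [folklore] -/
theorem pderiv_shear_self' [Fintype σ] (c : σ → κ) (i₀ : σ) (P : MvPolynomial σ κ) :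
    pderiv i₀ (aeval (fun i => if i = i₀ then C (c i₀) * X i₀ else X i + C (c i) * X i₀) P) =
      aeval (fun i => if i = i₀ then C (c i₀) * X i₀ else X i + C (c i) * X i₀) (∑ k, c k • pderiv k P) := by
  rw [pderiv_shear_self, map_sum]
  exact Finset.sum_congr rfl fun k _ => by rw [map_smul]

/-- **The descent space is transported by the shear**: `c ∈ W(Φ)` iff `e_{i₀} ∈ W(θ_c Φ)` (`c_{i₀} ≠ 0`). [folklore] -/
theorem mem_descentSpace_iff_shear [Fintype σ] {c : σ → κ} {i₀ : σ} (hc : c i₀ ≠ 0) (Φ : MvPolynomial σ κ) :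
    c ∈ descentSpace κ Φ ↔ (Pi.single i₀ 1 : σ → κ) ∈ descentSpace κ
      (aeval (fun i => if i = i₀ then C (c i₀) * X i₀ else X i + C (c i) * X i₀) Φ) := by
  unfold descentSpace
  simp only [Set.mem_setOf_eq]
  rw [sum_single_smul]
  constructor
  · rintro ⟨h1, h2⟩
    refine ⟨by rw [pderiv_shear_self', h1, map_zero], fun j => ?_⟩
    by_cases hj : j = i₀
    · subst hj
      rw [pderiv_shear_self', h1, map_zero]
      exact isLineInvariant_zero _
    · rw [pderiv_shear_of_ne c hj]
      exact (isLineInvariant_iff_shear hc _).mp (h2 j)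
  · rintro ⟨h1, h2⟩
    -- `∂_c Φ = 0`, pulling back through the inverse shear
    have hD : (∑ k, c k • pderiv k Φ) = 0 := by
      rw [pderiv_shear_self'] at h1
      have := congrArg (aeval (fun i => if i = i₀ then C (c i₀)⁻¹ * X i₀ else X i - C (c i * (c i₀)⁻¹) * X i₀)) h1
      rwa [unshear_shear hc, map_zero] at this
    -- the partials off the pivot are `c`-invariant
    have hoff : ∀ j, j ≠ i₀ → IsLineInvariant κ c (pderiv j Φ) := fun j hj =>
      (isLineInvariant_iff_shear hc _).mpr (by rw [← pderiv_shear_of_ne c hj]; exact h2 j)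
    refine ⟨hD, fun j => ?_⟩
    by_cases hj : j = i₀
    · subst hj
      -- `∂_{i₀} Φ = -(c_{i₀})⁻¹ • Σ_{k ≠ i₀} c_k • ∂_k Φ`
      have hsplit := Finset.add_sum_erase Finset.univ (fun k => c k • pderiv k Φ) (Finset.mem_univ j)
      rw [hD] at hsplit
      have hexpr : pderiv j Φ = (c j)⁻¹ • (0 - ∑ k ∈ Finset.univ.erase j, c k • pderiv k Φ) := by
        have hneg : c j • pderiv j Φ = -(∑ k ∈ Finset.univ.erase j, c k • pderiv k Φ) :=
          eq_neg_of_add_eq_zero_left hsplit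
        rw [zero_sub, ← hneg, smul_smul, inv_mul_cancel₀ hc, one_smul]
      rw [hexpr]
      refine IsLineInvariant.smul _ ((isLineInvariant_zero c).sub (IsLineInvariant.sum _ fun k hk => ?_))
      exact (hoff k (Finset.ne_of_mem_erase hk)).smul _
    · exact hoff j hj

/-- **L2b — CHARACTERISATION OF THE DESCENT SPACE over a perfect field of characteristic `2`** (res-L0-w41-idea-1 card 7
`stub_descent_iff_sq_adapted`, PROVED for every vector `c`): `dΦ` descends along `c` iff `Φ` is, modulo a square,
invariant along the line `κ̄·c`. (`c = 0` is trivial; otherwise shear `c` to a coordinate vector `e_{i₀}`, where it is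
the support statement `single_mem_descentSpace_iff_exists_sq`.) [folklore] -/
theorem mem_descentSpace_iff_exists_sq [CharP κ 2] [PerfectField κ] [Fintype σ] (Φ : MvPolynomial σ κ)
    (c : σ → κ) :
    c ∈ descentSpace κ Φ ↔ ∃ Q : MvPolynomial σ κ, IsLineInvariant κ c (Φ + Q ^ 2) := by
  by_cases hc0 : c = 0
  · subst hc0
    exact ⟨fun _ => ⟨0, by rw [zero_pow two_ne_zero, add_zero]; exact isLineInvariant_zero_dir Φ⟩,
      fun _ => zero_mem_descentSpace Φ⟩
  · obtain ⟨i₀, hc⟩ : ∃ i₀, c i₀ ≠ 0 := Function.ne_iff.mp hc0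
    rw [mem_descentSpace_iff_shear hc, single_mem_descentSpace_iff_exists_sq]
    constructor
    · rintro ⟨Q', hQ'⟩
      refine ⟨aeval (fun i => if i = i₀ then C (c i₀)⁻¹ * X i₀ else X i - C (c i * (c i₀)⁻¹) * X i₀) Q',
        (isLineInvariant_iff_shear hc _).mpr ?_⟩
      rw [map_add, map_pow, shear_unshear hc]
      exact hQ'
    · rintro ⟨Q, hQ⟩
      refine ⟨aeval (fun i => if i = i₀ then C (c i₀) * X i₀ else X i + C (c i) * X i₀) Q, ?_⟩
      have := (isLineInvariant_iff_shear hc _).mp hQ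
      rwa [map_add, map_pow] at this


end Shear

end Summit.ResolutionOfSingularities.ResolutionOfSingularities.Theorems.SwitchingDichotomy.DescentSpace

end
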